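import Literature.Probability.Percolation.CriticalTwoArmsPersistence
import HarnessLib

/-!
# Aizenman's slab criterion for `ℤ³`, I: gluing of regular cells and the same-`p` finite-size criterion
# (abstract form: the cell / block regions and the regularity events are variables)

builds on p205010 (kernel theorem, internal audit signed; external expert review pending)

RSW3 lane (post-continuity programme, LANE 3), seat `prim-rsw3-p2` (gen 3), METHOD "3D RSW-lite from continuity".
Helper file for the crux `stmt-CriticalPhenomena-4575` (`--supports`). No definitions, no named facts, no sorries.

This is the first of three files formalising, for bond percolation on `ℤ³`, Theorem 2 of
M. Aizenman, *On the number of incipient spanning clusters*, Nucl. Phys. B 485 (1997) 551–582, §2: at `p_c`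
thin slab-boxes are traversed by MORE THAN ONE spanning cluster with probability bounded below uniformly in the
scale.  Aizenman's proof (p. 3 of arXiv:cond-mat/9609240, criterion (ii)) is a same-density real-space
renormalisation: tile the slab `[0, tL] × ℝ²` by cells indexed by `ℤ²`; a cell is REGULAR if (i) it is
crossed in the thin direction and (ii) the `3 × 3` block of cells around it is traversed by exactly one
spanning cluster; chains of `★`-adjacent regular cells glue their spanning clusters, so a Peierls estimate
on the planar cell lattice turns "`P(cell irregular)` small at ONE scale" into percolation — impossible at
`p ≤ p_c`.

This file is the ABSTRACT half (the regions `cell b`, `block b ⊆ ℤ³`, the faces `F₀, F₁` and the events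
`good b`, `b ∈ ℤ²`, are variables subject to the four structural hypotheses actually used):
* `exists_percolatesAt_of_infinite_starCluster_cells` — deterministic gluing: if cell `0` is regular and its
  `★`-cluster of regular cells is infinite, some vertex of cell `0` lies in an infinite open cluster
  (Aizenman: "if within the 2D array there is a chain of neighboring regular cells, then the spanning
  clusters of these cells belong to a common connected cluster");
* `theta_pos_of_sparse_bound_cells` — the same-`p` criterion: if moreover the irregularity events of
  `6`-sparse families of cells obey the product bound with the tree's `★`-Peierls constant
  `δ₂ = KestenZhang.critTwoArmsDelta 2` (range `r = 6` on the cell lattice `ℤ²`), then `θ(p) > 0`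
  (`le_measureReal_infinite_starCluster_of_good` of `DependentStarPercolation.lean` in place of Aizenman's
  "20 possibilities per step" count; the template is `KestenZhang.theta_pos_of_real_compl_glueGoodO_le`).
The concrete cells and blocks are supplied in `…Rsw3SlabBlocks.lean`; the theorem at `p_c` in
`…Rsw3SlabSpanningClusters.lean`.

References: M. Aizenman, Nucl. Phys. B 485 (1997) 551–582, §2 Thm. 2 and criterion (ii) [Aizenman1997];
G. Grimmett, *Percolation* (1999), §7.4 (static renormalisation) [GrimmettPercolation1999];
J. van den Berg, D. van Engelenburg (2022) §3 Observation 8 (the tree's template) [VandenbergVanengelenburg2022].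
-/

noncomputable section

namespace Summit.CriticalPhenomena.PercolationContinuityZ3.Theorems.Rsw3

open MeasureTheory Literature.Probability.LatticeModels Literature.Probability.Percolation
open Literature.Probability.Percolation.KestenZhang SimpleGraph Relation

/-- **Gluing of regular cells (Aizenman 1997, proof of Thm. 2, the observation after (i)–(ii)).**  Abstract
form.  Let `cell, block : ℤ² → Set ℤ³` be regions, `F₀, F₁ ⊆ ℤ³` the two faces, and `good : ℤ² → events`
such that, in the configuration `ω`: a good cell `b` is crossed (`∃ x ∈ cell b ∩ F₀`, `y ∈ F₁`, `x ↔ y` inside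
`cell b`); a good cell `b` has the uniqueness property of its block (two open paths inside `block b` from `F₀`
to `F₁` are joined inside `block b`); `★`-adjacent cells lie in each other's blocks; distinct cells are
disjoint.  If cell `0` is good and the `★`-cluster of `0` in the set of good cells is infinite, then some
vertex of `cell 0` lies in an infinite open cluster: consecutive good cells of a `★`-chain have their
crossings joined inside the block of the first, and distinct cells carry distinct witnesses.
[cite: Aizenman1997, §2 (proof of Thm. 2: "the spanning clusters of these cells belong to a common connected cluster")] -/
theorem exists_percolatesAt_of_infinite_starCluster_cells
    {cell block : Site 2 → Set (Site 3)} {F₀ F₁ : Set (Site 3)}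
    {good : Site 2 → Set (BondConfig (Site 3))} {ω : BondConfig (Site 3)}
    (hcross : ∀ b, ω ∈ good b → ∃ x ∈ cell b, x ∈ F₀ ∧ ∃ y ∈ F₁, ω ∈ inConn (cell b) x y)
    (huniq : ∀ b, ω ∈ good b → ∀ x ∈ F₀, ∀ x' ∈ F₀, ∀ y ∈ F₁, ∀ y' ∈ F₁,
      ω ∈ inConn (block b) x y → ω ∈ inConn (block b) x' y' → ω ∈ inConn (block b) x x')
    (hcb : ∀ b b', supDist b b' ≤ 1 → cell b' ⊆ block b)
    (hinj : ∀ b b' x, x ∈ cell b → x ∈ cell b' → b = b')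
    (h0 : ω ∈ good 0) (hinf : {z : Site 2 | ReflTransGen (starRel {b | ω ∈ good b}) 0 z}.Infinite) :
    ∃ u ∈ cell 0, ω ∈ percolatesAt u := by
  classical
  set G : Set (Site 2) := {b | ω ∈ good b} with hG
  -- witnesses: the face-`F₀` endpoint of a crossing of the cell
  let wit : Site 2 → Site 3 := fun z => if h : ω ∈ good z then Classical.choose (hcross z h) else 0
  have hwit : ∀ z ∈ G, wit z ∈ cell z ∧ wit z ∈ F₀ ∧ ∃ y ∈ F₁, ω ∈ inConn (cell z) (wit z) y := by
    intro z hz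
    have hz' : ω ∈ good z := hz
    obtain ⟨hx, hF, y, hy, hxy⟩ := Classical.choose_spec (hcross z hz')
    have hw : wit z = Classical.choose (hcross z hz') := by simp only [wit, dif_pos hz']
    rw [hw]
    exact ⟨hx, hF, y, hy, hxy⟩
  have h0G : (0 : Site 2) ∈ G := h0
  -- `★`-adjacent good cells glue inside the block of the first
  have hglue : ∀ y z, y ∈ G → z ∈ G → supDist y z ≤ 1 → (openGraph ω).Reachable (wit y) (wit z) := by
    intro y z hyG hzG hyz
    obtain ⟨-, hFy, t, ht, hct⟩ := hwit y hyG
    obtain ⟨-, hFz, t', ht', hct'⟩ := hwit z hzG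
    have h1 : ω ∈ inConn (block y) (wit y) t :=
      inConn_mono (hcb y y (by rw [supDist_self]; exact zero_le_one)) _ _ hct
    have h2 : ω ∈ inConn (block y) (wit z) t' := inConn_mono (hcb y z hyz) _ _ hct'
    have h3 := huniq y hyG (wit y) hFy (wit z) hFz t ht t' ht' h1 h2
    exact (mem_inConn_iff.1 h3).mono inf_le_left
  have hchain : ∀ z, ReflTransGen (starRel G) 0 z → (openGraph ω).Reachable (wit 0) (wit z) := by
    intro z hz
    induction hz with
    | refl => exact Reachable.refl _
    | @tail y z _ hyz ih =>
      obtain ⟨hadj, hyG, hzG⟩ := hyz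
      exact ih.trans (hglue y z hyG hzG (zdStar_adj.1 hadj).2)
  -- distinct good cells have distinct witnesses
  have hmemG : ∀ z ∈ {z : Site 2 | ReflTransGen (starRel G) 0 z}, z ∈ G := fun z hz =>
    mem_of_reflTransGen_starRel hz h0G
  have hinj' : Set.InjOn wit {z : Site 2 | ReflTransGen (starRel G) 0 z} := by
    intro z hz z' hz' h
    refine hinj z z' (wit z) (hwit z (hmemG z hz)).1 ?_
    rw [h]
    exact (hwit z' (hmemG z' hz')).1
  have himage : (wit '' {z : Site 2 | ReflTransGen (starRel G) 0 z}).Infinite := hinf.image hinj'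
  have hsub : wit '' {z : Site 2 | ReflTransGen (starRel G) 0 z} ⊆ openCluster ω (wit 0) := by
    rintro _ ⟨z, hz, rfl⟩
    exact hchain z hz
  exact ⟨wit 0, (hwit 0 h0G).1, himage.mono hsub⟩

/-- **Aizenman's same-`p` finite-size criterion, abstract form** ("if `(1 − R_{L/3,3t}) + D_{L,t}` is too
small then there is percolation", criterion (ii) of Aizenman 1997 §2, with the tree's `★`-Peierls count).  Bond
percolation on `ℤ³` at ANY density `p`; cells `cell b`, blocks `block b` (`b ∈ ℤ²`), faces `F₀, F₁` and
regularity events `good b` as in `exists_percolatesAt_of_infinite_starCluster_cells` (cell `0` a nonempty finite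
set), and suppose the irregularity events satisfy the SPARSE PRODUCT BOUND: for every finite `T ⊆ ℤ²` whose
points are pairwise at sup-distance `≥ 7`, `P_p(⋂_{b ∈ T} (good b)ᶜ) ≤ δ₂^{49 · #T}` with
`δ₂ = KestenZhang.critTwoArmsDelta 2 = 1/(2 · 51 · 200^{49})`.  Then `θ(p) > 0`.  Proof: with probability
`≥ 1/2` cell `0` is regular with an infinite `★`-cluster of regular cells
(`le_measureReal_infinite_starCluster_of_good`, `d = 2`, `r = 6`); on that event a vertex of cell `0`
percolates (`exists_percolatesAt_of_infinite_starCluster_cells`); union bound over cell `0` and translation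
invariance of `θ`.  No sprinkling.  [cite: Aizenman1997, §2 criterion (ii) ("Prob(cell is irregular)·20 < 1" ⇒ percolation)] -/
theorem theta_pos_of_sparse_bound_cells (p : unitInterval)
    {cell block : Site 2 → Set (Site 3)} {F₀ F₁ : Set (Site 3)} {good : Site 2 → Set (BondConfig (Site 3))}
    (cell₀ : Finset (Site 3)) (hcell₀ : cell 0 = ↑cell₀) (hne : cell₀.Nonempty)
    (hcross : ∀ ω b, ω ∈ good b → ∃ x ∈ cell b, x ∈ F₀ ∧ ∃ y ∈ F₁, ω ∈ inConn (cell b) x y)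
    (huniq : ∀ ω b, ω ∈ good b → ∀ x ∈ F₀, ∀ x' ∈ F₀, ∀ y ∈ F₁, ∀ y' ∈ F₁,
      ω ∈ inConn (block b) x y → ω ∈ inConn (block b) x' y' → ω ∈ inConn (block b) x x')
    (hcb : ∀ b b', supDist b b' ≤ 1 → cell b' ⊆ block b)
    (hinj : ∀ b b' x, x ∈ cell b → x ∈ cell b' → b = b')
    (hsparse : ∀ T : Finset (Site 2), (∀ b ∈ T, ∀ b' ∈ T, b ≠ b' → 6 < supDist b b') →
      (bondPercolation (zdGraph 3) p).real (⋂ b ∈ T, (good b)ᶜ) ≤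
        critTwoArmsDelta 2 ^ ((6 + 1) ^ 2 * T.card)) :
    0 < theta (zdGraph 3) (0 : Site 3) p := by
  classical
  set μ := bondPercolation (zdGraph 3) p with hμ
  have hhalf := le_measureReal_infinite_starCluster_of_good (μ := μ) (le_refl 2) good
    (critTwoArmsDelta_pos 2).le (critTwoArmsDelta_spec 2) hsparse
  -- on that event some vertex of cell `0` percolates
  have hperc : (1 : ℝ) / 2 ≤ μ.real (⋃ u ∈ cell₀, percolatesAt u) := by
    refine hhalf.trans (measureReal_mono ?_ (measure_ne_top _ _))
    intro ω hω
    obtain ⟨u, hu, hup⟩ := exists_percolatesAt_of_infinite_starCluster_cells (hcross ω) (huniq ω) hcb hinj hω.1 hω.2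
    rw [hcell₀] at hu
    exact Set.mem_biUnion hu hup
  -- union bound and translation invariance
  have hsum : μ.real (⋃ u ∈ cell₀, percolatesAt u) ≤ (cell₀.card : ℝ) * theta (zdGraph 3) (0 : Site 3) p := by
    calc μ.real (⋃ u ∈ cell₀, percolatesAt u) ≤ ∑ u ∈ cell₀, μ.real (percolatesAt u) :=
          measureReal_biUnion_finset_le _ _
      _ = ∑ _u ∈ cell₀, theta (zdGraph 3) (0 : Site 3) p :=
          Finset.sum_congr rfl fun u _ => theta_zdGraph_eq_theta_zero p u
      _ = (cell₀.card : ℝ) * theta (zdGraph 3) (0 : Site 3) p := by rw [Finset.sum_const, nsmul_eq_mul]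
  have hcard : (0 : ℝ) < cell₀.card := by exact_mod_cast Finset.card_pos.2 hne
  by_contra hθ
  push Not at hθ
  have : (cell₀.card : ℝ) * theta (zdGraph 3) (0 : Site 3) p ≤ 0 := mul_nonpos_of_nonneg_of_nonpos hcard.le hθ
  linarith

end Summit.CriticalPhenomena.PercolationContinuityZ3.Theorems.Rsw3

end
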